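import Mathlib
import Summits.ValiantsHypothesis.ValiantsHypothesis.Statement
import Summits.ValiantsHypothesis.ValiantsHypothesis.Theorems.SoloInformedUnivariatePolynomial
import HarnessLib

/-!
# Pencil girth, part 1: Sidon separation, prescribed supports, independence of wedges (soloist, s35)

Support lemmas for `SoloInformedPencilGirth`: a `(K,h)`-free set with `K ≥ 4`, `h ≥ 1` is Sidon
(`SoloNatFree.sidon`); the submodule `soloSuppIn F S` of polynomials supported in `S`; linear
independence of products `A_i B_j` of sparse independent families on a Sidon grid
(`solo_linearIndependent_mul`) and of the wedges `P(i,j) - P(j,i)` (`solo_linearIndependent_wedge`).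
-/

namespace Summit.ValiantsHypothesis.ValiantsHypothesis.Theorems

open Finset Polynomial Module
open scoped Pointwise

/-! ### Sidon separation from freeness -/

/-- From `(K,h)`-freeness with `K ≥ 4`, `h ≥ 1`: a coincidence `u + u' = v + v'` among elements
of `E` with `u ≠ u'`, `v ≠ v'` is trivial (`{u,u'} = {v,v'}`). -/
theorem SoloNatFree.sidon {K h : ℕ} {E : Finset ℕ} (hE : SoloNatFree K h E) (hK : 4 ≤ K)
    (hh : 1 ≤ h) {u u' v v' : ℕ} (hu : u ∈ E) (hu' : u' ∈ E) (hv : v ∈ E) (hv' : v' ∈ E)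
    (huu' : u ≠ u') (hvv' : v ≠ v') (hsum : u + u' = v + v') :
    (u = v ∧ u' = v') ∨ (u = v' ∧ u' = v) := by
  classical
  set c : ℕ → ℤ := fun n =>
    (if n = u then 1 else 0) + (if n = u' then 1 else 0) - (if n = v then 1 else 0) -
      (if n = v' then 1 else 0) with hc
  have hsupp : (E.filter fun e => c e ≠ 0).card ≤ K := by
    refine le_trans (card_le_card ?_)
      (le_trans (Finset.card_le_four (a := u) (b := u') (c := v) (d := v')) hK)
    intro n hn
    rw [mem_filter] at hn
    by_contra hne
    simp only [mem_insert, mem_singleton, not_or] at hne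
    apply hn.2
    simp only [hc, if_neg hne.1, if_neg hne.2.1, if_neg hne.2.2.1, if_neg hne.2.2.2]
    norm_num
  have habs : ∀ n, |c n| ≤ h := by
    intro n
    have h1 : (1 : ℤ) ≤ h := by exact_mod_cast hh
    have hA0 : 0 ≤ (if n = u then (1:ℤ) else 0) + (if n = u' then 1 else 0) :=
      add_nonneg (by split_ifs <;> norm_num) (by split_ifs <;> norm_num)
    have hA1 : (if n = u then (1:ℤ) else 0) + (if n = u' then 1 else 0) ≤ 1 := by
      by_cases hn : n = u
      · rw [if_pos hn, if_neg (fun h2 => huu' (hn.symm.trans h2))]; norm_num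
      · rw [if_neg hn, zero_add]; split_ifs <;> norm_num
    have hB0 : 0 ≤ (if n = v then (1:ℤ) else 0) + (if n = v' then 1 else 0) :=
      add_nonneg (by split_ifs <;> norm_num) (by split_ifs <;> norm_num)
    have hB1 : (if n = v then (1:ℤ) else 0) + (if n = v' then 1 else 0) ≤ 1 := by
      by_cases hn : n = v
      · rw [if_pos hn, if_neg (fun h2 => hvv' (hn.symm.trans h2))]; norm_num
      · rw [if_neg hn, zero_add]; split_ifs <;> norm_num
    have : |c n| ≤ 1 := by
      rw [abs_le]
      simp only [hc]
      constructor <;> linarith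
    exact this.trans h1
  have key : ∀ w ∈ E, (∑ e ∈ E, (if e = w then (1:ℤ) else 0) * (e : ℤ)) = w := by
    intro w hw
    rw [Finset.sum_eq_single w]
    · simp
    · intro e _ hne
      simp [hne]
    · intro h
      exact absurd hw h
  have hsum0 : (∑ e ∈ E, c e * (e : ℤ)) = 0 := by
    simp only [hc, sub_mul, add_mul, Finset.sum_sub_distrib, Finset.sum_add_distrib, key u hu,
      key u' hu', key v hv, key v' hv']
    have := congrArg (Nat.cast : ℕ → ℤ) hsum
    push_cast at this
    linarith
  have h0 := hE c hsupp habs hsum0 u hu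
  simp only [hc, if_neg huu'] at h0
  by_cases huv : u = v
  · left
    exact ⟨huv, by omega⟩
  · right
    rw [if_neg huv] at h0
    by_cases huv' : u = v'
    · exact ⟨huv', by omega⟩
    · rw [if_neg huv'] at h0
      norm_num at h0

/-! ### Polynomials with prescribed support -/

/-- The subspace of polynomials supported in `S`. -/
def soloSuppIn (F : Type*) [Semiring F] (S : Set ℕ) : Submodule F F[X] where
  carrier := {f | ∀ k ∉ S, f.coeff k = 0}
  zero_mem' := by intro k _; simp
  add_mem' := by
    intro f g hf hg k hk
    simp [hf k hk, hg k hk]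
  smul_mem' := by
    intro r f hf k hk
    simp [hf k hk]

/-- Membership in `soloSuppIn`. -/
theorem mem_soloSuppIn {F : Type*} [Semiring F] {S : Set ℕ} {f : F[X]} :
    f ∈ soloSuppIn F S ↔ ∀ k ∉ S, f.coeff k = 0 := Iff.rfl

/-- `soloSuppIn` is monotone in the support set. -/
theorem soloSuppIn_mono {F : Type*} [Semiring F] {S T : Set ℕ} (h : S ⊆ T) :
    soloSuppIn F S ≤ soloSuppIn F T := fun _ hf k hk => hf k fun hkS => hk (h hkS)

/-- Polynomials supported in `S` and in `Sᶜ` meet trivially. -/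
theorem soloSuppIn_disjoint_compl {F : Type*} [Semiring F] (S : Set ℕ) :
    Disjoint (soloSuppIn F S) (soloSuppIn F Sᶜ) := by
  rw [Submodule.disjoint_def]
  intro f hf hf'
  ext k
  by_cases hk : k ∈ S
  · rw [coeff_zero]; exact hf' k (fun h => h hk)
  · rw [coeff_zero]; exact hf k hk

/-- Monomials with exponent in `S` lie in `soloSuppIn F S`. -/
theorem X_pow_mem_soloSuppIn {F : Type*} [Semiring F] {S : Set ℕ} {e : ℕ} (he : e ∈ S) :
    (X : F[X]) ^ e ∈ soloSuppIn F S := by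
  intro k hk
  rw [coeff_X_pow, if_neg]
  rintro rfl
  exact hk he

/-- Products: `supp f ⊆ S`, `supp g ⊆ T` ⟹ `supp (f g) ⊆ S + T`. -/
theorem mul_mem_soloSuppIn {F : Type*} [CommSemiring F] {S T : Finset ℕ} {f g : F[X]}
    (hf : f ∈ soloSuppIn F (S : Set ℕ)) (hg : g ∈ soloSuppIn F (T : Set ℕ)) :
    f * g ∈ soloSuppIn F ((S + T : Finset ℕ) : Set ℕ) := by
  classical
  intro k hk
  rw [coeff_mul]
  refine Finset.sum_eq_zero fun x hx => ?_
  rw [HasAntidiagonal.mem_antidiagonal] at hx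
  by_cases h1 : x.1 ∈ S
  · by_cases h2 : x.2 ∈ T
    · exfalso
      apply hk
      rw [Finset.mem_coe, ← hx]
      exact Finset.add_mem_add h1 h2
    · rw [hg x.2 (by simpa using h2), mul_zero]
  · rw [hf x.1 (by simpa using h1), zero_mul]

/-! ### Independence of products and wedges of sparse families -/

/-- If `A_i` are independent and supported in `Sa`, `B_j` independent and supported in `Sb`, and
addition `Sa × Sb → ℕ` is injective ("Sidon"), then the products `A_i B_j` are independent. -/
theorem solo_linearIndependent_mul {F : Type*} [Field F] {m n : ℕ} {Sa Sb : Finset ℕ}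
    (hS : ∀ u ∈ Sa, ∀ u' ∈ Sb, ∀ v ∈ Sa, ∀ v' ∈ Sb, u + u' = v + v' → u = v)
    {A : Fin m → F[X]} {B : Fin n → F[X]} (hA : LinearIndependent F A)
    (hB : LinearIndependent F B) (hAs : ∀ i, ∀ k ∉ Sa, (A i).coeff k = 0)
    (hBs : ∀ j, ∀ k ∉ Sb, (B j).coeff k = 0) :
    LinearIndependent F (fun ij : Fin m × Fin n => A ij.1 * B ij.2) := by
  classical
  rw [Fintype.linearIndependent_iff]
  intro g hg
  set P : Fin n → F[X] := fun j => ∑ i, g (i, j) • A i with hP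
  have hPs : ∀ j, ∀ k ∉ Sa, (P j).coeff k = 0 := by
    intro j k hk
    simp only [hP, finsetSum_coeff, coeff_smul, hAs _ k hk, smul_zero, sum_const_zero]
  have hsum : ∑ j, P j * B j = 0 := by
    have : ∑ j, P j * B j = ∑ ij : Fin m × Fin n, g ij • (A ij.1 * B ij.2) := by
      rw [Fintype.sum_prod_type, Finset.sum_comm]
      simp only [hP, Finset.sum_mul, smul_mul_assoc]
    rw [this, hg]
  have hcoef : ∀ u ∈ Sa, ∀ u', ∑ j, (P j).coeff u * (B j).coeff u' = 0 := by
    intro u hu u'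
    by_cases hu' : u' ∈ Sb
    · have h1 : (∑ j, P j * B j).coeff (u + u') = ∑ j, (P j).coeff u * (B j).coeff u' := by
        rw [finsetSum_coeff]
        refine Finset.sum_congr rfl fun j _ => ?_
        rw [coeff_mul, Finset.sum_eq_single (u, u')]
        · intro x hx hne
          rw [HasAntidiagonal.mem_antidiagonal] at hx
          by_cases hx1 : x.1 ∈ Sa
          · by_cases hx2 : x.2 ∈ Sb
            · exfalso
              apply hne
              have h3 := hS x.1 hx1 x.2 hx2 u hu u' hu' hx
              exact Prod.ext h3 (by simp only at h3 ⊢; omega)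
            · rw [hBs j _ hx2, mul_zero]
          · rw [hPs j _ hx1, zero_mul]
        · intro h
          have hm : (u, u') ∈ antidiagonal (u + u') := HasAntidiagonal.mem_antidiagonal.mpr rfl
          exact absurd hm h
      rw [← h1, hsum, coeff_zero]
    · simp only [hBs _ u' hu', mul_zero, sum_const_zero]
  have hR : ∀ u ∈ Sa, ∀ j, (P j).coeff u = 0 := by
    intro u hu
    have hRu : ∑ j, (P j).coeff u • B j = 0 := by
      ext k
      simp only [finsetSum_coeff, coeff_smul, smul_eq_mul, coeff_zero]
      exact hcoef u hu k
    exact (Fintype.linearIndependent_iff.mp hB) _ hRu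
  have hP0 : ∀ j, P j = 0 := by
    intro j
    ext k
    by_cases hk : k ∈ Sa
    · rw [hR k hk j, coeff_zero]
    · rw [hPs j k hk, coeff_zero]
  intro ij
  have := (Fintype.linearIndependent_iff.mp hA) (fun i => g (i, ij.2)) (by
    have := hP0 ij.2
    simpa only [hP] using this)
  exact this ij.1

/-- Wedges `P(i,j) - P(j,i)`, `i < j`, of an independent family `P` on `Fin m × Fin m` are
independent. -/
theorem solo_linearIndependent_wedge {F V : Type*} [Field F] [AddCommGroup V] [Module F V]
    {m : ℕ} {P : Fin m × Fin m → V} (hP : LinearIndependent F P) :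
    LinearIndependent F
      (fun k : {ij : Fin m × Fin m // ij.1 < ij.2} => P k.1 - P k.1.swap) := by
  classical
  rw [Fintype.linearIndependent_iff]
  intro g hg
  set G : Fin m × Fin m → F := fun ij => if h : ij.1 < ij.2 then g ⟨ij, h⟩ else 0 with hG
  have hGk : ∀ k : {ij : Fin m × Fin m // ij.1 < ij.2}, G k.1 = g k := by
    intro k
    simp only [hG, dif_pos k.2]
  have part1 : ∀ Q : Fin m × Fin m → V,
      ∑ ij, G ij • Q ij = ∑ k : {ij : Fin m × Fin m // ij.1 < ij.2}, g k • Q k.1 := by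
    intro Q
    rw [← Finset.sum_filter_of_ne (p := fun ij : Fin m × Fin m => ij.1 < ij.2)
      (s := Finset.univ) (f := fun ij => G ij • Q ij)]
    · rw [Finset.sum_subtype (Finset.univ.filter fun ij : Fin m × Fin m => ij.1 < ij.2)
        (p := fun ij : Fin m × Fin m => ij.1 < ij.2) (by simp)]
      exact Finset.sum_congr rfl fun k _ => by rw [hGk]
    · intro ij _ hne
      by_contra hlt
      apply hne
      simp only [hG, dif_neg hlt, zero_smul]
  have part2 : ∑ ij, G ij.swap • P ij = ∑ k : {ij : Fin m × Fin m // ij.1 < ij.2},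
      g k • P k.1.swap := by
    rw [Fintype.sum_equiv (Equiv.prodComm (Fin m) (Fin m)) (fun ij => G ij.swap • P ij)
      (fun ij => G ij • P ij.swap) (fun ij => rfl)]
    exact part1 (fun ij => P ij.swap)
  have key : ∑ ij, (G ij - G ij.swap) • P ij = 0 := by
    simp only [sub_smul, Finset.sum_sub_distrib, part1 P, part2, ← hg, smul_sub]
  have hz := (Fintype.linearIndependent_iff.mp hP) _ key
  intro k
  have h1 := hz k.1
  have h2 : ¬ k.1.swap.1 < k.1.swap.2 := by
    simp only [Prod.fst_swap, Prod.snd_swap, not_lt]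
    exact le_of_lt k.2
  rw [hGk k] at h1
  simp only [hG, dif_neg h2, sub_zero] at h1
  exact h1

/-- `#{(i,j) : i < j < m} = C(m,2)`. -/
theorem solo_card_ltPairs (m : ℕ) :
    Fintype.card {ij : Fin m × Fin m // ij.1 < ij.2} = m.choose 2 := by
  classical
  rw [Fintype.card_subtype, Finset.card_filter, Fintype.sum_prod_type]
  have h1 : ∀ i : Fin m, (∑ j : Fin m, if i < j then 1 else 0) = m - 1 - (i : ℕ) := by
    intro i
    rw [← Finset.card_filter, Finset.filter_lt_eq_Ioi, Fin.card_Ioi]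
  simp only [h1]
  rw [Fin.sum_univ_eq_sum_range (fun i => m - 1 - i) m, Finset.sum_range_reflect (fun i => i) m,
    Nat.choose_two_right]
  have := Finset.sum_range_id_mul_two m
  omega


/-! ### Monomial combinations -/

/-- Coefficients of a combination of monomials `Σ_{e ∈ T} c_e X^e`. -/
theorem solo_coeff_monComb {F : Type*} [CommSemiring F] (T : Finset ℕ) (c : ↥T → F) (k : ℕ) :
    (Fintype.linearCombination F (fun e : ↥T => (X : F[X]) ^ (e : ℕ)) c).coeff k =
      if hk : k ∈ T then c ⟨k, hk⟩ else 0 := by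
  classical
  rw [Fintype.linearCombination_apply, finsetSum_coeff]
  simp only [coeff_smul, coeff_X_pow, smul_eq_mul, mul_ite, mul_one, mul_zero]
  split_ifs with hk
  · rw [Finset.sum_eq_single ⟨k, hk⟩]
    · simp
    · intro e _ hne
      rw [if_neg]
      intro h
      exact hne (Subtype.ext h.symm)
    · intro h
      exact absurd (Finset.mem_univ _) h
  · refine Finset.sum_eq_zero fun e _ => ?_
    rw [if_neg]
    intro h
    exact hk (h ▸ e.2)

end Summit.ValiantsHypothesis.ValiantsHypothesis.Theorems
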